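import Summits.KontsevichZagierPeriods.KontsevichZagierPeriods.Theorems.VietaFibreKernelFormAveraging
import HarnessLib

/-!
# Crux `KernelForm` (stmt-KontsevichZagierPeriods-10447), line `Sketch`: thin cancellation reduces
# to unit-cube representations

One stub of the line lead's skeleton over the Kontsevich–Zagier calculus of `KZCalculus.lean`
(no new definitions):

* `thinCancellation_iff_cubeRep` — the thin-cancellation statement "a class `c` which is killed,
  modulo the moves, by `1 + [K]` for thin compact volume forms `K` (constant positive rational
  integrand, compact domain with non-empty interior) of arbitrarily small value is `≡ 0`" is
  equivalent to its restriction to the classes `c = [W]` of SINGLE representations `W` on a unit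
  cube `[0,1]^m = KZ.cube m`.

Proof. `→` is specialisation to `c := [W]`. `←`: by the averaging normal form
(`exists_cubeRep_integrand_sub_eval_le` of `VietaFibreKernelFormAveraging.lean`) every `c` is
move-equivalent to one unit-cube representation `W`, i.e. `c - [W] ∈ KZ.relations`; since
`KZ.relations` is a left ideal (`KZ.mul_mem_relations_left_holds`), the identity
`[W] + [K]·[W] = (c + [K]·c) - ((c - [W]) + [K]·(c - [W]))` transports every thin canceller
`1 + [K]` of `c` to one of `[W]` (same `K`), so `[W] ∈ KZ.relations` by the cube case, and then
`c = (c - [W]) + [W] ∈ KZ.relations`.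

References: M. Kontsevich, D. Zagier, *Periods* (2001), §1.2 (rules (1)–(3) and Conjecture 1),
§4.1 (products of representations).
-/

noncomputable section

open MeasureTheory Set
open Literature.NumberTheory.Transcendental

namespace Summit.KontsevichZagierPeriods.KernelForm.LocaliseAtValuePrime

/-- **Thin cancellation reduces to unit-cube representations.** The statement "every formal
combination `c` admitting, for every `ε > 0`, a thin compact volume form `K` (constant positive
rational integrand on a compact domain with non-empty interior) of value `< ε` with
`c + [K]·c ∈ KZ.relations` is itself a relation" is equivalent to the same statement for the
classes `[W]` of single representations `W` with domain the unit cube `KZ.cube m`: every `c` is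
move-equivalent to such a `[W]` by the averaging normal form `exists_cubeRep_integrand_sub_eval_le`,
and thin cancellers of `c` are thin cancellers of `[W]` because `KZ.relations` is a left ideal.
[folklore] -/
theorem thinCancellation_iff_cubeRep :
    (∀ c : KZ.FormalRep, (∀ ε : ℝ, 0 < ε → ∃ (k : ℕ) (K : KZ.IntegralRep (k + 1)) (κ : ℚ), 0 < κ ∧
        IsCompact K.domain ∧ (interior K.domain).Nonempty ∧ (∀ x ∈ K.domain, K.integrand x = κ) ∧
        KZ.eval (KZ.of K) < ε ∧ c + KZ.of K * c ∈ KZ.relations) → c ∈ KZ.relations) ↔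
    (∀ (m : ℕ) (W : KZ.IntegralRep m), W.domain = KZ.cube m →
      (∀ ε : ℝ, 0 < ε → ∃ (k : ℕ) (K : KZ.IntegralRep (k + 1)) (κ : ℚ), 0 < κ ∧
        IsCompact K.domain ∧ (interior K.domain).Nonempty ∧ (∀ x ∈ K.domain, K.integrand x = κ) ∧
        KZ.eval (KZ.of K) < ε ∧ KZ.of W + KZ.of K * KZ.of W ∈ KZ.relations) →
      KZ.of W ∈ KZ.relations) := by
  constructor
  · -- specialise to the class of one cube representation
    intro h m W _ hW
    exact h (KZ.of W) hW
  · intro h c hthin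
    -- averaging normal form: `c ≡ [W]` with `W` on the unit cube
    obtain ⟨m, hm⟩ := exists_cubeRep_integrand_sub_eval_le c
    obtain ⟨W, hWd, -, hcW⟩ := hm 1 one_pos
    have hW : KZ.of W ∈ KZ.relations := by
      refine h m W hWd fun ε hε => ?_
      obtain ⟨k, K, κ, hκ, hKc, hKi, hKκ, hKε, hK⟩ := hthin ε hε
      refine ⟨k, K, κ, hκ, hKc, hKi, hKκ, hKε, ?_⟩
      have e : KZ.of W + KZ.of K * KZ.of W =
          (c + KZ.of K * c) - ((c - KZ.of W) + KZ.of K * (c - KZ.of W)) := by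
        rw [mul_sub]; abel
      rw [e]
      -- `relations` is an additive subgroup and a left ideal
      exact KZ.relations.sub_mem hK
        (KZ.relations.add_mem hcW (KZ.mul_mem_relations_left_holds _ (KZ.of K) hcW))
    have e : c = (c - KZ.of W) + KZ.of W := by abel
    rw [e]
    exact KZ.relations.add_mem hcW hW

end Summit.KontsevichZagierPeriods.KernelForm.LocaliseAtValuePrime
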